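import Literature.Barriers.NavierStokesRegularity.SharpLpLinftyNonuniqueness
import Literature.Analysis.FluidPDE.NavierStokesReynoldsWeakLimit
import Literature.Analysis.FluidPDE.NavierStokesReynoldsProofs
import HarnessLib

/-!
# Cheskidov–Luo 2022, Thm. 1.7 from the main iteration (Prop. 2.2): the assembly of §2.6

The accepted named fact `CheskidovLuo2022MainTheorem`
(`Literature/Barriers/NavierStokesRegularity/SharpLpLinftyNonuniqueness`) renders Thm. 1.7 of
A. Cheskidov, X. Luo, *Sharp nonuniqueness for the Navier–Stokes equations*, Invent. Math. 229
(2022) 987–1054 = arXiv:2009.06596. The paper proves it in §2.6 ASSUMING the main iteration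
proposition, Prop. 2.2 — the accepted named fact `Torus.CheskidovLuo2022MainIteration` of
`Literature.Analysis.FluidPDE.NavierStokesReynolds` (itself reduced to Props. 3.1 and 4.1 by the
proved `Torus.CheskidovLuo2022MainIteration_of_steps`). This file PROVES that reduction
(sibling of the barrier file and of `SharpLpLinftyNonuniquenessProofs`, which deduces the
barrier Thm. 1.6 from Thm. 1.7):

* `CheskidovLuo2022MainTheorem_of_mainIteration :
    (∀ n, Torus.CheskidovLuo2022MainIteration (d := Fin n)) → CheskidovLuo2022MainTheorem`.

Once `Torus.CheskidovLuo2022MainIteration` is discharged (`…_holds`), the discharge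
`CheskidovLuo2022MainTheorem_holds` is the one-line application of this theorem.

## The printed proof (§2.6) and its formalisation

"Let `u₀ = v` and `R₀ = ℛ(∂ₜu₀ - Δu₀ + div(u₀ ⊗ u₀))` … `(u₀, R₀)` solves (2.1) trivially and is
well-prepared for `I = [0,1]` and `τ = 1`" — `exists_isNSReynoldsOn_of_smooth` (the source
`∂ₜv + (v·∇)v - Δv` has zero mean because `v` is divergence free with zero mean; the
antidivergence is the proved `Torus.exists_smooth_antidivergence_holds`; the vacuous
well-preparedness is `Torus.isWellPrepared_Icc`). "Given `(uₙ₋₁, Rₙ₋₁)`, we apply Proposition 2.2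
with the parameter `δₙ` … to obtain `(uₙ, Rₙ)`" — `exists_cheskidovLuoSequence` iterates the fact
(by `Nat.rec` through `Classical.choice`, stages recorded as `CheskidovLuoStage`) with the sizes
`δₖ = ηₖ²`, `ηₖ = (ε'/2) 2⁻ᵏ`, `ε' = min ε ½` (print: `δₙ = 2⁻ⁿ min(‖Rₙ₋₁‖, ε)`; any summable choice
with `∑_{k≥1} δₖ ≤ ε` and `∑ δₖ^{1/2} < ∞` serves, the square root coming from the `L²` clause of
the rendered Prop. 2.2), and packages the output as a `Torus.CheskidovLuoSequence`
(`Literature.Analysis.FluidPDE.NavierStokesReynoldsLimit`). Everything else of §2.6 — the limit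
`u`, `u ∈ L^p L^∞` with `‖u - v‖ ≤ ∑ δₖ ≤ ε`, the weak formulation in the limit, the intervals of
regularity and `dim_𝓗 ≤ ε`, agreement with the classical solution near `t = 0` — is proved for
abstract sequences in `NavierStokesReynoldsLimit` / `NavierStokesReynoldsWeakLimit` and is read
off here. The exponent of well-preparedness is taken to be `ε' = min ε ½ ∈ (0, 1)` (print: "assume
`0 < ε < 1` without loss of generality"), which only improves the dimension bound.

## References

* A. Cheskidov, X. Luo, Invent. Math. 229 (2022) 987–1054; arXiv:2009.06596: Thm. 1.7, Prop. 2.2,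
  §2.6. [`CheskidovLuo2022`]
-/

noncomputable section

open MeasureTheory Set Filter
open scoped ENNReal NNReal _root_.Topology
open Literature.Analysis Literature.Analysis.FluidPDE

namespace Literature.Barriers.NavierStokesRegularity

/-- Local notation: the flat `n`-torus `𝕋ⁿ = (ℝ/ℤ)ⁿ`. -/
local notation "𝕋^" n => UnitAddTorus (Fin n)
/-- Local notation: the value space `ℝⁿ`. -/
local notation "ℝ^" n => EuclideanSpace ℝ (Fin n)

variable {n : ℕ}

/-! ## Step `0`: the given field as a Navier–Stokes–Reynolds solution -/

/-- **The start of the iteration** (CL22, §2.6: "Let `u₀ = v` and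
`R₀ = ℛ(∂ₜu₀ - Δu₀ + div(u₀ ⊗ u₀))` … Since the given vector field `v` has zero spatial mean for
each `t`, `(u₀, R₀)` solves (2.1) trivially"): for `n ≥ 2`, `T > 0` and `v` jointly smooth on
`[0, T] × 𝕋ⁿ`, divergence free and of zero mean at each time, there is a Reynolds stress `R₀`
with `(v, 0, R₀)` a smooth solution of the Navier–Stokes–Reynolds system on `[0, T]`. The source
`f = ∂ₜv + (v·∇)v - Δv` has zero mean (`∫ ∂ₜv = d/dt ∫ v = 0`, `∫ (v·∇)v = 0` for divergence-free
`v`, `∫ Δv = ∑ᵢ ∫ ∂ᵢ∂ᵢv = 0`), so the proved antidivergence fact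
`Torus.exists_smooth_antidivergence_holds` applies. [cite: CheskidovLuo2022, §2.6 (proof of Thm. 1.7)] -/
theorem exists_isNSReynoldsOn_of_smooth (hn : 2 ≤ n) {T : ℝ} (hT : 0 < T) {v : ℝ → (𝕋^n) → ℝ^n}
    (hv : FunctionSpaces.Torus.IsSmoothSpaceTimeOn (Icc 0 T) v)
    (hdiv : ∀ t ∈ Icc 0 T, FunctionSpaces.Torus.IsDivFree (v t))
    (hmean : ∀ t ∈ Icc 0 T, FunctionSpaces.Torus.HasZeroMean (v t)) :
    ∃ R : ℝ → (𝕋^n) → Fin n → ℝ^n, Torus.IsNSReynoldsOn (Icc 0 T) 1 v (fun _ _ => 0) R := by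
  have hU : UniqueDiffOn ℝ (Icc 0 T) := uniqueDiffOn_Icc hT
  -- the source `f = ∂ₜv + (v·∇)v - Δv`
  set f : ℝ → (𝕋^n) → ℝ^n := fun t x => FunctionSpaces.Torus.timeDerivWithin (Icc 0 T) v t x +
    FunctionSpaces.Torus.convect (v t) (v t) x - FunctionSpaces.Torus.laplacian (v t) x with hf_def
  have hf : FunctionSpaces.Torus.IsSmoothSpaceTimeOn (Icc 0 T) f :=
    ((hv.timeDerivWithin hU).add (hv.convect hv hU)).sub (hv.laplacian hU)
  have hfmean : ∀ t ∈ Icc 0 T, FunctionSpaces.Torus.HasZeroMean (f t) := by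
    intro t ht
    have hvt : FunctionSpaces.Torus.IsSmooth (v t) := hv.isSmooth_slice ht
    -- `∫ ∂ₜv(t) = 0`: the derivative within `[0, T]` of the constant `s ↦ ∫ v(s) = 0`
    have h1 : ∫ x, FunctionSpaces.Torus.timeDerivWithin (Icc 0 T) v t x = 0 := by
      have hd := hv.hasDerivWithinAt_integral (convex_Icc 0 T) ht
      have hd0 : HasDerivWithinAt (fun s => ∫ x, v s x) 0 (Icc 0 T) t :=
        (hasDerivWithinAt_const t (Icc 0 T) (0 : ℝ^n)).congr_of_mem (fun s hs => hmean s hs) ht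
      exact (hU t ht).eq_deriv _ hd hd0
    -- `∫ (v·∇)v = 0` for divergence-free `v`
    have h2 : ∫ x, FunctionSpaces.Torus.convect (v t) (v t) x = 0 :=
      FunctionSpaces.Torus.integral_fderiv_apply_eq_zero_of_isDivFree hvt hvt (hdiv t ht)
    -- `∫ Δv = ∑ᵢ ∫ ∂ᵢ∂ᵢ v = 0`
    have h3 : ∫ x, FunctionSpaces.Torus.laplacian (v t) x = 0 := by
      rw [integral_congr_ae (ae_of_all _ fun x =>
        FunctionSpaces.Torus.laplacian_eq_sum_partialDeriv_partialDeriv hvt x),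
        integral_finsetSum _ fun i _ => ((hvt.partialDeriv i).partialDeriv i).integrable]
      exact Finset.sum_eq_zero fun i _ =>
        FunctionSpaces.Torus.integral_partialDeriv_eq_zero_holds (hvt.partialDeriv i) i
    have i1 : Integrable (FunctionSpaces.Torus.timeDerivWithin (Icc 0 T) v t) volume :=
      ((hv.timeDerivWithin hU).isSmooth_slice ht).integrable
    have i2 : Integrable (FunctionSpaces.Torus.convect (v t) (v t)) volume := (hvt.convect hvt).integrable
    have i3 : Integrable (FunctionSpaces.Torus.laplacian (v t)) volume := hvt.laplacian.integrable
    have i12 : Integrable (fun x => FunctionSpaces.Torus.timeDerivWithin (Icc 0 T) v t x +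
        FunctionSpaces.Torus.convect (v t) (v t) x) volume := i1.add i2
    change ∫ x, f t x = 0
    simp only [hf_def]
    rw [integral_sub i12 i3, integral_add i1 i2, h1, h2, h3]
    simp
  obtain ⟨R, hR, hsymm, htr, hdivR⟩ :=
    Torus.exists_smooth_antidivergence_holds (d := Fin n) (by simpa using hn) T f hf hfmean
  refine ⟨R, ?_⟩
  exact
    { smooth_velocity := hv
      smooth_pressure := contDiffOn_const
      smooth_stress := hR
      momentum := fun t ht x => by
        rw [hdivR t ht x, Torus.gradient_zero, one_smul, add_zero]
        simp only [hf_def]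
        abel
      divFree := hdiv
      symm := hsymm
      traceFree := htr
      hasZeroMean_pressure := fun t _ => by simp [FunctionSpaces.Torus.HasZeroMean] }

/-! ## The iteration -/

/-- A stage of the Cheskidov–Luo iteration on `[0, T]` (the hypotheses of Prop. 2.2): a smooth
solution `(u, P, R)` of the Navier–Stokes–Reynolds system on `[0, T] × 𝕋ⁿ` with zero-mean
velocity, well-prepared (Def. 2.1, exponent `ε`) for a set `I` and a scale `τ`. [cite: CheskidovLuo2022, Prop. 2.2] -/
structure CheskidovLuoStage (n : ℕ) (T ε : ℝ) where
  /-- The velocity. -/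
  u : ℝ → (𝕋^n) → ℝ^n
  /-- The pressure. -/
  P : ℝ → (𝕋^n) → ℝ
  /-- The Reynolds stress (by columns). -/
  R : ℝ → (𝕋^n) → Fin n → ℝ^n
  /-- The set of the well-prepared configuration. -/
  I : Set ℝ
  /-- The length scale. -/
  τ : ℝ
  /-- `(u, P, R)` solves the Navier–Stokes–Reynolds system on `[0, T]`. -/
  nsr : Torus.IsNSReynoldsOn (Icc 0 T) 1 u P R
  /-- The velocity has zero spatial mean. -/
  mean : ∀ t ∈ Icc 0 T, FunctionSpaces.Torus.HasZeroMean (u t)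
  /-- `(u, R)` is well-prepared for `(I, τ)`. -/
  wp : Torus.IsWellPrepared T ε R I τ

/-- The conclusion of Prop. 2.2 (as rendered in `Torus.CheskidovLuo2022MainIteration`) between a
stage `s` and a next stage `s'`, for the parameters `p, M, r` and the smallness `δ`: `I' ⊆ I`,
`0, T ∉ I'`, `τ' < τ/2`, `‖R'‖_{L¹Lʳ} ≤ δ`, `u' = u` off `I` and at `t = 0`,
`‖u' - u‖_{L²L²} ≤ M ‖R‖_{L¹Lʳ}^{1/2}`, `‖u' - u‖_{L^pL^∞} ≤ δ`. [cite: CheskidovLuo2022, Prop. 2.2] -/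
def CheskidovLuoStage.IsNext {T ε : ℝ} (p M r δ : ℝ) (s s' : CheskidovLuoStage n T ε) : Prop :=
  s'.I ⊆ s.I ∧ (0 : ℝ) ∉ s'.I ∧ T ∉ s'.I ∧ s'.τ < s.τ / 2 ∧
  Torus.eLqLpNorm 1 (ENNReal.ofReal r) s'.R (Ioo 0 T) ≤ ENNReal.ofReal δ ∧
  (∀ t ∈ Icc 0 T, t ∉ s.I → s'.u t = s.u t) ∧ s'.u 0 = s.u 0 ∧
  Torus.eLqLpNorm 2 2 (fun t x => s'.u t x - s.u t x) (Ioo 0 T) ≤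
    ENNReal.ofReal M * Torus.eLqLpNorm 1 (ENNReal.ofReal r) s.R (Ioo 0 T) ^ (1 / 2 : ℝ) ∧
  Torus.eLqLpNorm (ENNReal.ofReal p) ⊤ (fun t x => s'.u t x - s.u t x) (Ioo 0 T) ≤ ENNReal.ofReal δ

/-- **The iteration of §2.6**: assuming Prop. 2.2 (`Torus.CheskidovLuo2022MainIteration`) in
dimension `n ≥ 2`, for `T > 0`, `0 < ε < 1`, `1 ≤ p < 2` and every `v` jointly smooth on
`[0, T] × 𝕋ⁿ`, divergence free and of zero mean at each time, there is a Cheskidov–Luo sequence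
(`Torus.CheskidovLuoSequence`) on `[0, T]` with exponent `ε`, starting from `u₀ = v`, whose sizes
satisfy `∑_{k ≥ 1} δₖ ≤ ε` ("Given `(uₙ₋₁, Rₙ₋₁)`, we apply Proposition 2.2 with the parameter
`δₙ` … to obtain `(uₙ, Rₙ)`"; here `δₖ = ηₖ²` with `ηₖ = (ε/2) 2⁻ᵏ`, so that `∑ₖ M δₖ^{1/2} < ∞`
controls the `L²` increments and `‖Rₖ‖_{L¹L¹} ≤ ‖Rₖ‖_{L¹Lʳ} ≤ δₖ → 0`). [cite: CheskidovLuo2022, §2.6 (proof of Thm. 1.7)] -/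
theorem exists_cheskidovLuoSequence (hIter : Torus.CheskidovLuo2022MainIteration (d := Fin n))
    (hn : 2 ≤ n) {T : ℝ} (hT : 0 < T) {ε : ℝ} (hε : 0 < ε) (hε1 : ε < 1) {p : ℝ} (hp1 : 1 ≤ p)
    (hp2 : p < 2) {v : ℝ → (𝕋^n) → ℝ^n} (hv : FunctionSpaces.Torus.IsSmoothSpaceTimeOn (Icc 0 T) v)
    (hdiv : ∀ t ∈ Icc 0 T, FunctionSpaces.Torus.IsDivFree (v t))
    (hmean : ∀ t ∈ Icc 0 T, FunctionSpaces.Torus.HasZeroMean (v t)) :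
    ∃ D : Torus.CheskidovLuoSequence (Fin n) T ε p, D.U 0 = v ∧ ∑' j, D.δ (j + 1) ≤ ε := by
  obtain ⟨R₀, hR₀⟩ := exists_isNSReynoldsOn_of_smooth hn hT hv hdiv hmean
  obtain ⟨M, hM, r, hr, hstep⟩ := hIter (by simpa using hn) T hT ε hε hε1 p hp1 hp2
  -- the sizes `δₖ = ηₖ²`, `ηₖ = (ε/2)/2^k`
  set η : ℕ → ℝ := fun k => ε / 2 / 2 ^ k with hη_def
  set δ : ℕ → ℝ := fun k => η k ^ 2 with hδ_def
  have hηpos : ∀ k, 0 < η k := fun k => by positivity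
  have hη_le : ∀ k, η k ≤ 1 := fun k => by
    have h2 : (1 : ℝ) ≤ 2 ^ k := one_le_pow₀ (by norm_num)
    rw [hη_def]
    exact (div_le_self (by positivity) h2).trans (by linarith)
  have hδpos : ∀ k, 0 < δ k := fun k => by positivity
  have hδη : ∀ k, δ k ≤ η k := fun k => by
    rw [hδ_def]; dsimp only
    nlinarith [hηpos k, hη_le k]
  have hη_sum : Summable η := by
    have h := summable_geometric_two.mul_left (ε / 2)
    refine h.congr fun k => ?_
    rw [hη_def]; dsimp only
    rw [one_div, inv_pow]
    ring
  have hη_tsum : ∑' k, η k = ε := tsum_geometric_two' ε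
  have hδ_sum : Summable δ := Summable.of_nonneg_of_le (fun k => (hδpos k).le) hδη hη_sum
  have hsqrt : ∀ k, δ k ^ (1 / 2 : ℝ) = η k := fun k => by
    rw [hδ_def]; dsimp only
    rw [← Real.sqrt_eq_rpow, Real.sqrt_sq (hηpos k).le]
  -- one step of Prop. 2.2 from any stage
  have hnext : ∀ (k : ℕ) (s : CheskidovLuoStage n T ε), ∃ s' : CheskidovLuoStage n T ε,
      s.IsNext p M r (δ (k + 1)) s' := by
    intro k s
    obtain ⟨u₁, P₁, R₁, I, τ, hnsr, hm, hwp, hI, h0, hT', hτ, hRle, hoff, hz, hl2, hlp⟩ :=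
      hstep (δ (k + 1)) (hδpos _) s.u s.P s.R s.I s.τ s.nsr s.mean s.wp
    exact ⟨⟨u₁, P₁, R₁, I, τ, hnsr, hm, hwp⟩, hI, h0, hT', hτ, hRle, hoff, hz, hl2, hlp⟩
  choose next hnext using hnext
  let s₀ : CheskidovLuoStage n T ε :=
    ⟨v, fun _ _ => 0, R₀, Icc (-(2 * T)) (3 * T), T, hR₀, hmean, Torus.isWellPrepared_Icc hT ε R₀⟩
  let S : ℕ → CheskidovLuoStage n T ε := fun k => Nat.rec s₀ (fun k s => next k s) k
  have hS : ∀ k, S (k + 1) = next k (S k) := fun k => rfl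
  have hrel : ∀ k, (S k).IsNext p M r (δ (k + 1)) (S (k + 1)) := fun k => by
    rw [hS]; exact hnext k (S k)
  -- the mixed norms along the sequence
  have hstress : ∀ k, Torus.eLqLpNorm 1 1 (S (k + 1)).R (Ioo 0 T) ≤ ENNReal.ofReal (δ (k + 1)) :=
    fun k => (Torus.eLqLpNorm_mono_exponent_of_smooth (S (k + 1)).nsr.smooth_stress 1
      (ENNReal.one_le_ofReal.2 hr.le)).trans (hrel k).2.2.2.2.1
  have hl2 : ∀ k, Torus.eLqLpNorm 2 2 (fun t x => (S (k + 2)).u t x - (S (k + 1)).u t x) (Ioo 0 T) ≤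
      ENNReal.ofReal M * ENNReal.ofReal (η (k + 1)) := by
    intro k
    refine (hrel (k + 1)).2.2.2.2.2.2.2.1.trans ?_
    gcongr
    calc Torus.eLqLpNorm 1 (ENNReal.ofReal r) (S (k + 1)).R (Ioo 0 T) ^ (1 / 2 : ℝ)
        ≤ ENNReal.ofReal (δ (k + 1)) ^ (1 / 2 : ℝ) :=
          ENNReal.rpow_le_rpow (hrel k).2.2.2.2.1 (by norm_num)
      _ = ENNReal.ofReal (η (k + 1)) := by
          rw [ENNReal.ofReal_rpow_of_nonneg (hδpos _).le (by norm_num), hsqrt]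
  refine ⟨{ U := fun k => (S k).u
            P := fun k => (S k).P
            R := fun k => (S k).R
            I := fun k => (S k).I
            τ := fun k => (S k).τ
            δ := δ
            T_pos := hT
            ε_nonneg := hε.le
            ε_lt_one := hε1
            one_le_p := hp1
            nsr := fun k => (S k).nsr
            hasZeroMean := fun k => (S k).mean
            wellPrepared := fun k => (S k).wp
            I_succ_subset := fun k => (hrel k).1
            zero_not_mem := fun k => (hrel k).2.1
            T_not_mem := fun k => (hrel k).2.2.1
            τ_succ_le := fun k => (hrel k).2.2.2.1.le
            U_succ_eq := fun k => (hrel k).2.2.2.2.2.1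
            U_succ_zero := fun k => (hrel k).2.2.2.2.2.2.1
            δ_nonneg := fun k => (hδpos k).le
            summable_δ := hδ_sum
            eLqLpNorm_sub_le := fun k => (hrel k).2.2.2.2.2.2.2.2
            tsum_eLqLpNorm_two_ne_top := ?_
            tendsto_eLqLpNorm_stress := ?_ }, rfl, ?_⟩
  · -- `∑ₖ ‖uₖ₊₁ - uₖ‖_{L²L²} ≤ ‖u₁ - u₀‖ + M ∑ₖ ηₖ₊₁ < ∞`
    rw [tsum_eq_zero_add' ENNReal.summable]
    refine ENNReal.add_ne_top.2 ⟨?_, ?_⟩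
    · refine ne_top_of_le_ne_top ?_ (hrel 0).2.2.2.2.2.2.2.1
      refine ENNReal.mul_ne_top ENNReal.ofReal_ne_top (ENNReal.rpow_ne_top_of_nonneg (by norm_num) ?_)
      exact ((S 0).nsr.smooth_stress.eLqLpNorm_lt_top le_rfl _).ne
    · refine ne_top_of_le_ne_top ?_ (ENNReal.tsum_le_tsum hl2)
      rw [ENNReal.tsum_mul_left, ← ENNReal.ofReal_tsum_of_nonneg (fun k => (hηpos _).le)
        ((summable_nat_add_iff 1).2 hη_sum)]
      exact ENNReal.mul_ne_top ENNReal.ofReal_ne_top ENNReal.ofReal_ne_top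
  · -- `‖Rₖ‖_{L¹L¹} ≤ ‖Rₖ‖_{L¹Lʳ} ≤ δₖ → 0`
    have hδ0 : Tendsto (fun k => ENNReal.ofReal (δ (k + 1))) atTop (𝓝 0) := by
      rw [← ENNReal.ofReal_zero]
      exact ENNReal.tendsto_ofReal ((tendsto_add_atTop_iff_nat 1).2 hδ_sum.tendsto_atTop_zero)
    have h : Tendsto (fun k => Torus.eLqLpNorm 1 1 (S (k + 1)).R (Ioo 0 T)) atTop (𝓝 0) :=
      tendsto_of_tendsto_of_tendsto_of_le_of_le tendsto_const_nhds hδ0 (fun k => bot_le) hstress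
    exact (tendsto_add_atTop_iff_nat 1).1 h
  · -- `∑_{j} δ_{j+1} ≤ ∑_{j} η_{j+1} ≤ ∑ η = ε`
    calc ∑' j, δ (j + 1) ≤ ∑' j, η (j + 1) :=
          ((summable_nat_add_iff 1).2 hδ_sum).tsum_le_tsum (fun j => hδη _)
            ((summable_nat_add_iff 1).2 hη_sum)
      _ ≤ ∑' j, η j := by
          rw [hη_sum.tsum_eq_zero_add]
          linarith [hηpos 0]
      _ = ε := hη_tsum

/-! ## Thm. 1.7 from Prop. 2.2 -/

/-- **Cheskidov–Luo 2022, Thm. 1.7 follows from the main iteration Prop. 2.2** (the assembly of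
§2.6, "we prove Theorem 1.7 … assuming Proposition 2.2"): if the rendered Prop. 2.2,
`Torus.CheskidovLuo2022MainIteration`, holds in every dimension `Fin n`, then the accepted named
fact `CheskidovLuo2022MainTheorem` holds. Given `n ≥ 2`, `T > 0`, `1 ≤ p < 2`, `ε > 0` and `v`,
run the iteration with the exponent `ε' = min ε ½` (`exists_cheskidovLuoSequence`) and take the
limit field `u = D.lim` of the resulting Cheskidov–Luo sequence: it is a weak solution with datum
`v(0)` (`isWeakNSSolutionWithDataOn_lim`), of zero mean for a.e. `t` (`hasZeroMean_lim`), in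
`L^p(0,T;L^∞)` (`memLqLp_lim`), equal on some `[0, τ]` to the classical solution `u₁` from
`v(0)` (`exists_isClassicalNSSolutionOn_near_zero`), smooth on the open set of regular times
whose complement in `[0, T]` has Hausdorff dimension `≤ ε' ≤ ε`
(`isSmoothSpaceTimeOn_lim_regularSet`, `dimH_Icc_diff_regularSet_le`), and
`‖u - v‖_{L^p(0,T;L^∞)} ≤ ∑ₖ δₖ₊₁ ≤ ε' ≤ ε` (`eLqLpNorm_lim_sub_le`). [cite: CheskidovLuo2022, Thm. 1.7 and §2.6] -/
theorem CheskidovLuo2022MainTheorem_of_mainIteration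
    (hIter : ∀ n : ℕ, Torus.CheskidovLuo2022MainIteration (d := Fin n)) :
    CheskidovLuo2022MainTheorem := by
  intro n hn T hT p hp1 hp2 ε hε v hv hdiv hmean
  set ε' : ℝ := min ε (1 / 2) with hε'
  have hε'0 : 0 < ε' := lt_min hε (by norm_num)
  have hε'1 : ε' < 1 := lt_of_le_of_lt (min_le_right _ _) (by norm_num)
  have hε'ε : ε' ≤ ε := min_le_left _ _
  obtain ⟨D, hU0, hδ⟩ := exists_cheskidovLuoSequence (hIter n) hn hT hε'0 hε'1 hp1 hp2 hv hdiv hmean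
  refine ⟨D.lim, ?_, ?_, D.memLqLp_lim, ?_, ?_, ?_⟩
  · have h := D.isWeakNSSolutionWithDataOn_lim
    rwa [hU0] at h
  · exact ae_restrict_of_forall_mem measurableSet_Ioo fun t ht =>
      D.hasZeroMean_lim (Ioo_subset_Icc_self ht)
  · obtain ⟨τ₁, h0, hτT, hcl, hinit, heq⟩ := D.exists_isClassicalNSSolutionOn_near_zero
    exact ⟨τ₁, h0, hτT, D.U 1, D.P 1, hcl, by rw [hinit, hU0], heq⟩
  · exact ⟨D.regularSet, D.isOpen_regularSet, D.regularSet_subset,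
      D.isSmoothSpaceTimeOn_lim_regularSet,
      D.dimH_Icc_diff_regularSet_le.trans (ENNReal.ofReal_le_ofReal hε'ε)⟩
  · calc Torus.eLqLpNorm (ENNReal.ofReal p) ⊤ (D.lim - v) (Ioo 0 T)
        = Torus.eLqLpNorm (ENNReal.ofReal p) ⊤ (fun t x => D.lim t x - D.U 0 t x) (Ioo 0 T) := by
          rw [hU0]; rfl
      _ ≤ ENNReal.ofReal (∑' j, D.δ (j + 1)) := D.eLqLpNorm_lim_sub_le
      _ ≤ ENNReal.ofReal ε := ENNReal.ofReal_le_ofReal (hδ.trans hε'ε)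

end Literature.Barriers.NavierStokesRegularity
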